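import Mathlib
import HarnessLib
import Summits.HubbardSuperconductivity.HubbardSuperconductivity.Theorems.KLProgrammeKLRegimeTwoCutoffScaleZeroBound
import Summits.HubbardSuperconductivity.HubbardSuperconductivity.Theorems.KLProgrammeKLRegimeEngineScaleZeroValuesExplicit
import Summits.HubbardSuperconductivity.HubbardSuperconductivity.Theorems.KLProgrammeKLRegimeEngineFramePosKernelPieces
import Literature.MathematicalPhysics.QuantumLattice.HubbardMatsubaraShellBandL1

/-!
# Route `KLProgramme` — ENGINE child `KLRegimeEngineV16` (stmt-HubbardSuperconductivity-20236), `stub_twoLeg_scale0`, conjunct (E3f-AT)₀,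
# the CUTOFF leg: the sub-dyadic step with the MODEL SIZES of an admissible frame (cell gate-hubbard-kl, seat hubbard-kl-k3c4-p2 g6; route (C))

Sequel of `…TwoCutoffScaleZeroBound`.  Every size hypothesis of `abs_klLocalPart_zero_twoCutoff_sub_le_closed` is discharged for an admissible frame
(`FrameOK R U N μ K`, `R.WF`, `0 < U ≤ 1`, `klBetaMin ≤ β ≤ L`, `β³ ≤ M″`, shell floor `e₀ ≤ π(2M+1)/β`):

* infrared constant `κ² = 6047` (`…FrameShellCount.infraredGram_frame_le` at `Λ = e₀ = 1/32`);
* vertex profile `n4 = |U||β|/N`, `n2 = (|β|/N)·c_K`, `c_K = κ_R·|U|` the position `ℓ¹` norm of the frame kernel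
  (`…EngineFramePosKernelPieces.sum_norm_framePosKernel_le_linear_of_frameOK`, `sum_norm_kernel_gridVertex_le_l1`);
* shell equal-time entry `tE = (4+|μ|+c_K)β/(2π²M)` and shell row sums `α_S = N/(π√(2M)) + Nβc/(2π²M) + NL²c²β²/(2π³M(2M+1))`,
  `c = 4+|μ|+c_K` (`HubbardMatsubaraShellBandL1`);
* cutoff-`M″` row sums `α″ = (N/β)·klScaleZeroA0` (`…EngineScaleZeroValuesExplicit.rowSum_scaleZero_le_A0`).

**`abs_klLocalPart_zero_twoCutoff_sub_le_sizes`**: with these sizes (passed as reals with their defining equations) and the two smallness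
conditions as hypotheses, `|klLocalPart L M … 0 θ − klLocalPart L M″ … 0 θ| ≤ (2·4M″/|β|)·(4e·VD/κ_C²)`.  The sequel discharges the smallness and
the `O(β/√M)` size at the `klEng` thresholds and chains the sub-dyadic steps.  Proof only; no definitions.
-/

noncomputable section

namespace Summit.HubbardSuperconductivity.HubbardSuperconductivity.Theorems.TwoVolumeDefect

set_option linter.dupNamespace false -- summit = problem name (single-conjunct summit), D-0017

open Finset Literature.MathematicalPhysics.QuantumLattice Literature.Probability.LatticeModels GrassmannAlgebra
open Summit.HubbardSuperconductivity.HubbardSuperconductivity.Theorems.KLRegimeSplit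
open Summit.HubbardSuperconductivity.HubbardSuperconductivity.Theorems.KLProgrammeLegKernels
open Summit.HubbardSuperconductivity.HubbardSuperconductivity.Theorems.EngineV8

variable {L M M'' : ℕ} [NeZero L]

/-- **The infrared constant of the scale-`0` weight is `≤ 6047` for every admissible frame** (`klBetaMin ≤ β ≤ L`, any cutoff):
the `hIR` hypothesis of the two-cutoff Gram bound with `κ = √6047` (the derivation inside `…FrameShellCount.isDetBoundedR_scaleZero_of_frameOK_sharp`,
exported). -/
theorem infraredSum_scaleZero_le_of_frameOK [NeZero M] {R : RenConsts} {U : ℝ} {Nsc : ℕ} {μ : ℝ} {K : TrigPolyC4v}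
    (hK : FrameOK R U Nsc μ K) {β : ℝ} (hβ : klBetaMin ≤ β) (hβL : β ≤ L) :
    1 / (β * (L : ℝ) ^ 2) * ∑ k : FreqMomentum L M,
        (1 - hubbardCutoffWeightCT L M β μ K klE0 k) / Real.sqrt (matsubaraFreq β M k.1 ^ 2 + nambuXiCT L μ K k.2 ^ 2) ≤
      (Real.sqrt 6047) ^ 2 := by
  have hβpos : 0 < β := lt_of_lt_of_le (by norm_num [klBetaMin]) hβ
  have hLpos : (0 : ℝ) < L := by exact_mod_cast Nat.pos_of_ne_zero (NeZero.ne L)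
  have he₀ : (0 : ℝ) < klE0 := by norm_num [klE0]
  have he₀' : klE0 ≤ 3 / 80 := by norm_num [klE0]
  have hπβ : Real.pi / β ≤ klE0 := by
    rw [div_le_iff₀ hβpos, klE0]
    have h128 : (128 : ℝ) ≤ β := by simpa [klBetaMin] using hβ
    nlinarith [Real.pi_lt_four]
  have hsum := infraredGram_frame_le (L := L) (M := M) hK hβpos he₀ hπβ he₀' hβL
  rw [Real.sq_sqrt (by norm_num)]
  have hβL2 : 0 < β * (L : ℝ) ^ 2 := by positivity
  rw [one_div, inv_mul_le_iff₀ hβL2]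
  refine hsum.trans ?_
  rw [klE0]
  nlinarith

/-- **THE SUB-DYADIC STEP WITH THE MODEL SIZES.**  For an admissible frame `K` (`FrameOK R U Nsc μ K`, `R.WF`), `0 < U ≤ 1`,
`klBetaMin ≤ β ≤ L`, cutoffs `1 ≤ M ≤ M″ ≤ 2M` with `β³ ≤ M″` and the shell floor `klE0 ≤ π(2M+1)/β`, and the sizes
`c_K = κ_R|U|`, `c = 4+|μ|+c_K`, `n2 = (|β|/N)c_K`, `n4 = |U||β|/N`, `tE = cβ/(2π²M)`, `α_S = N/(π√(2M)) + Nβc/(2π²M) + NL²c²β²/(2π³M(2M+1))`,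
`α″ = (N/β)·klScaleZeroA0` (`N = 4M″`), `κ_C = √(2(8+6047))`, `ρ_S, VS, θ_S, VC, VD` as in `…_closed`: if `θ_S ≤ 1/2` and
`e(α″+α_S)(VC+VD)/κ_C² ≤ 1/2` then `|klLocalPart L M … 0 θ − klLocalPart L M″ … 0 θ| ≤ (2N/|β|)·(4e·VD/κ_C²)`. -/
theorem abs_klLocalPart_zero_twoCutoff_sub_le_sizes [NeZero M] [NeZero M''] {R : RenConsts} (hR : R.WF) {U : ℝ} (hU : 0 < U) (hU1 : U ≤ 1)
    {Nsc : ℕ} {μ : ℝ} {K : TrigPolyC4v} (hK : FrameOK R U Nsc μ K) {β : ℝ} (hβ : klBetaMin ≤ β) (hβL : β ≤ L)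
    (hM : 1 ≤ M) (h : M ≤ M'') (hM2 : M'' ≤ 2 * M) (hβM : β ^ 3 ≤ (M'' : ℝ)) (hfloor : klE0 ≤ Real.pi * (2 * M + 1) / β)
    {cK c n2 n4 tE aS aC κC ρS VS θS VC VD : ℝ}
    (hcK : cK = klKappaFrameC R * |U|) (hc : c = 4 + |μ| + cK)
    (hn2 : n2 = |β| / ((2 * (2 * M'') : ℕ) : ℝ) * cK) (hn4 : n4 = |U| * |β| / ((2 * (2 * M'') : ℕ) : ℝ))
    (htE : tE = c * β / (2 * Real.pi ^ 2 * M))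
    (haS : aS = ((2 * (2 * M'') : ℕ) : ℝ) / (Real.pi * Real.sqrt (2 * M)) + ((2 * (2 * M'') : ℕ) : ℝ) * β * c / (2 * Real.pi ^ 2 * M) +
        ((2 * (2 * M'') : ℕ) : ℝ) * (L : ℝ) ^ 2 * c ^ 2 * β ^ 2 / (2 * Real.pi ^ 3 * M * (2 * M + 1)))
    (haC : aC = ((2 * (2 * M'') : ℕ) : ℝ) / β * klScaleZeroA0)
    (hκC : κC = Real.sqrt (2 * (8 + Real.sqrt 6047 ^ 2))) (hρS : ρS = 4 * Real.exp 2 * κC)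
    (hVS : VS = (Real.exp 2 * (1 + ρS)) ^ 2 * n2 + (Real.exp 2 * (1 + ρS)) ^ 4 * n4) (hθSdef : θS = Real.exp 1 * aS * VS)
    (hVC : VC = (Real.exp 2 * (κC + κC)) ^ 2 * n2 + (Real.exp 2 * (κC + κC)) ^ 4 * n4)
    (hVD : VD = (Real.exp 2 * (κC + κC)) ^ 2 * (6 * tE * n4) + (Real.exp 1 * VS * θS / (1 - θS)) / 3)
    (hθS : θS ≤ 1 / 2) (hθC : Real.exp 1 * (aC + aS) * (VC + VD) / κC ^ 2 ≤ 1 / 2)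
    (θ : ℝ) :
    |klLocalPart L M β U μ K 0 θ - klLocalPart L M'' β U μ K 0 θ| ≤
      2 * ((2 * (2 * M'') : ℕ) : ℝ) / |β| * (4 * Real.exp 1 * VD / κC ^ 2) := by
  haveI : NeZero (2 * (2 * M'')) := ⟨by have := NeZero.ne M''; omega⟩
  have hβpos : 0 < β := lt_of_lt_of_le (by norm_num [klBetaMin]) hβ
  have hΛ : (0 : ℝ) < klE0 := by norm_num [klE0]
  have hN : 2 * M'' ≤ 2 * (2 * M'') := by omega
  have hUabs : |U| = U := abs_of_pos hU
  have hU1' : |U| ≤ 1 := by rwa [hUabs]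
  -- the frame kernel's `ℓ¹` norm
  have hframe : ∑ z : TorusSite 2 L, ‖framePosKernel L K z‖ ≤ cK := by
    rw [hcK]; exact sum_norm_framePosKernel_le_linear_of_frameOK hR hU.ne' hU1' hK
  have hcK0 : 0 ≤ cK := (sum_nonneg fun z _ => norm_nonneg _).trans hframe
  have hc0 : 0 ≤ c := by rw [hc]; positivity
  -- the sizes
  have hIR := infraredSum_scaleZero_le_of_frameOK (L := L) (M := M'') hK hβ hβL
  have haCpos : 0 < aC := by
    rw [haC]
    have hN0' : (0 : ℝ) < ((2 * (2 * M'') : ℕ) : ℝ) := by exact_mod_cast Nat.pos_of_ne_zero (NeZero.ne (2 * (2 * M'')))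
    exact mul_pos (div_pos hN0' hβpos) klScaleZeroA0_pos
  have hM0 : (0 : ℝ) < M := by exact_mod_cast hM
  have hN0 : (0 : ℝ) < ((2 * (2 * M'') : ℕ) : ℝ) := by exact_mod_cast Nat.pos_of_ne_zero (NeZero.ne (2 * (2 * M'')))
  have hsq : 0 < Real.sqrt (2 * M) := Real.sqrt_pos.2 (by positivity)
  have haSpos : 0 < aS := by
    rw [haS]
    have h1 : 0 < ((2 * (2 * M'') : ℕ) : ℝ) / (Real.pi * Real.sqrt (2 * M)) := div_pos hN0 (mul_pos Real.pi_pos hsq)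
    have h2 : 0 ≤ ((2 * (2 * M'') : ℕ) : ℝ) * β * c / (2 * Real.pi ^ 2 * M) := by positivity
    have h3 : 0 ≤ ((2 * (2 * M'') : ℕ) : ℝ) * (L : ℝ) ^ 2 * c ^ 2 * β ^ 2 / (2 * Real.pi ^ 3 * M * (2 * M + 1)) := by positivity
    linarith
  have hrowC := fun X => rowSum_scaleZero_le_A0 (L := L) (M := M'') (μ := μ) hK hβ hβM X
  have hcolC := fun Y => colSum_scaleZero_le_A0 (L := L) (M := M'') (μ := μ) hK hβ hβM Y
  have hrowS : ∀ X, ∑ Y, ‖((hubbardGridSub L M'' β (2 * (2 * M''))).transpose * hubbardCovShellCT L h β μ 0 K klE0 *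
      hubbardGridSub L M'' β (2 * (2 * M''))) X Y‖ ≤ aS := fun X => by
    rw [haS, hc]; exact rowSum_gridSub_hubbardCovShellCT_le_l1 hβpos hM h hN μ K hframe hΛ hfloor X
  have hcolS : ∀ Y, ∑ X, ‖((hubbardGridSub L M'' β (2 * (2 * M''))).transpose * hubbardCovShellCT L h β μ 0 K klE0 *
      hubbardGridSub L M'' β (2 * (2 * M''))) X Y‖ ≤ aS := fun Y => by
    rw [haS, hc]; exact colSum_gridSub_hubbardCovShellCT_le_l1 hβpos hM h hN μ K hframe hΛ hfloor Y
  have htE0 : 0 ≤ tE := by rw [htE]; positivity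
  have htE' : ∀ A B : GridLeg (GridPoint L (2 * (2 * M''))), SameTime A B →
      ‖((hubbardGridSub L M'' β (2 * (2 * M''))).transpose * hubbardCovShellCT L h β μ 0 K klE0 *
        hubbardGridSub L M'' β (2 * (2 * M''))) A B‖ ≤ tE := fun A B hAB => by
    rw [htE, hc]; exact norm_gridSub_hubbardCovShellCT_le_of_sameTime_l1 hβpos hM h μ K hframe hΛ hfloor hAB
  have hn20 : 0 ≤ n2 := by rw [hn2]; positivity
  have hn40 : 0 ≤ n4 := by rw [hn4]; positivity
  have hNW : ∀ (n : ℕ) (p : Fin n) (w : GridLeg (GridPoint L (2 * (2 * M'')))),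
      ∑ Z ∈ univ.filter (fun Z : Fin n → GridLeg (GridPoint L (2 * (2 * M''))) => Z p = w),
        ‖kernel ℂ (hubbardGridInteraction L (2 * (2 * M'')) β U + hubbardGridCounterQuadratic L (2 * (2 * M'')) β K) n Z‖ ≤
          (if n = 4 then n4 else if n = 2 then n2 else 0) := by
    intro n p w
    refine (sum_norm_kernel_gridVertex_le_l1 β U K n p w).trans ?_
    rw [hn2, hn4]
    split_ifs
    · exact le_rfl
    · exact mul_le_mul_of_nonneg_left hframe (by positivity)
    · exact le_rfl
  exact abs_klLocalPart_zero_twoCutoff_sub_le_closed hβpos h hM2 U μ K hIR haCpos haSpos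
    (fun X => by rw [haC]; exact hrowC X) (fun Y => by rw [haC]; exact hcolC Y) hrowS hcolS htE0 htE' hn20 hn40 hNW
    hκC hρS hVS hθSdef hVC hVD hθS hθC θ

end Summit.HubbardSuperconductivity.HubbardSuperconductivity.Theorems.TwoVolumeDefect

end
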